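import Literature.NumberTheory.GaloisRepresentations.FrobeniusDensityTheorem
import Literature.NumberTheory.GaloisRepresentations.DecompositionGroupOfCompletion
import Literature.NumberTheory.GaloisRepresentations.DecomposedGeneric
import Literature.NumberTheory.Automorphic.GaloisActionPlaces
import Literature.NumberTheory.Automorphic.AdicCompletionLocalField
import Literature.NumberTheory.EllipticCurves.QuadraticTwistFramedTorsion
import Literature.NumberTheory.EllipticCurves.KummerUnramifiedConverse
import Literature.NumberTheory.EllipticCurves.KummerInertiaSurjectiveProofs
import HarnessLib

/-!
# The quadratic Kummer character of an auxiliary uniformizer and the inertia groups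

Topic `Literature/NumberTheory/GaloisRepresentations`.  Theorem-only file (no definition, no named
fact): the Galois-theoretic bookkeeping behind the classical trick of **twisting by an auxiliary
quadratic character ramified at one chosen place** (used e.g. to make a quadratic induction
`Ind_E^K(W ⊗ χ_γ)` residually irreducible via Mackey: `W ⊗ χ_γ` and its conjugate differ on an
inertia element at the auxiliary place), in the conventions of the tree
(`IntegralGaloisAction`: `𝔔 ∈ u.primesAbove`, `𝔔.inertia Γ_E`; `LocalGaloisGroup`: `absInertia`;
`WeierstrassCurve.geomSqrt`, `EllipticCurves.exists_continuousQuadraticCharacter`):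

* `exists_intValuation_eq_exp_neg_one_and_forall_not_mem` — an integer `γ ∈ 𝓞 E` which is a
  uniformizer at a given place `u₀` and a unit at finitely many other places (CRT);
* `HeightOneSpectrum.eventually_not_mem_asIdeal` — a non-zero integer lies in finitely many primes;
* `smul_ne_self_of_mem_splitPrimes` — above a prime of `K` split in a quadratic Galois `E/K`, the
  non-trivial automorphism moves every prime; `infinite_setOf_under_mem_splitPrimes` — there are
  infinitely many such primes of `E` (density `1/[E:K]`, `hasStrongDirichletDensity_splitPrimes`);
* `inertia_le_absGaloisGroupAdjoinRootsOfUnity` — `I_𝔔 ≤ Γ_{E(ζ_p)}` for `𝔔 ∣ u ∤ p`;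
  `absGaloisRestrict_mem_inertia_adicCompletionPrime` — `res(I_{E_u}) ⊆ I_{𝔓₀}`;
* `exists_kummerQuadraticCharacter` — for `γ ∈ 𝓞 E` a unit above the odd prime `p`, the
  continuous quadratic character `q' = χ_γ : Γ_E → {±1}` (`σ√γ = q'(σ)√γ`) is trivial on every
  inertia group above `p`, globally and locally (Lang, *FDG* Ch. 6 Prop. 1.3: `E(√γ)/E` is
  unramified at `u ∤ 2γ`);
* `exists_mem_inertia_smul_geomSqrt_eq_neg` — if `ord_{u₀}(γ) = 1` and `u₀ ∤ 2`, some inertia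
  element at `u₀` sends `√γ` to `-√γ` (the Kummer character of a uniformizer is onto `μ₂` on
  inertia, `exists_mem_absoluteGaloisGroup_inertia_smul_eq_pow_mul`).

## References

* S. Lang, *Fundamentals of Diophantine Geometry* (1983), Ch. 6 Prop. 1.3. [Lang1983]
* J.-P. Serre, Invent. Math. 15 (1972), §1.3–§1.5 (tame inertia). [Serre1972]
* J. W. S. Cassels, A. Fröhlich (eds.), *Algebraic Number Theory* (1967), Ch. VII Prop. 1.2
  (transitivity on primes). [CasselsFrohlichANT1967]
* D. A. Marcus, *Number Fields*, Ch. 7 Thm. 43 (density of split primes). [Marcus2018]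
-/

noncomputable section

open scoped NumberField Pointwise
open NumberField IsDedekindDomain Field Filter WeierstrassCurve

namespace Literature.NumberTheory.GaloisRepresentations

/-! ### Finitely many places contain a given non-zero integer -/

/-- A non-zero element of a Dedekind domain lies in only finitely many primes. [folklore] -/
theorem HeightOneSpectrum.eventually_not_mem_asIdeal {R : Type*} [CommRing R] [IsDedekindDomain R]
    {x : R} (hx : x ≠ 0) : ∀ᶠ v : HeightOneSpectrum R in cofinite, x ∉ v.asIdeal := by
  rw [Filter.eventually_cofinite]
  simp only [not_not]
  refine (Ideal.finite_factors (I := Ideal.span {x}) ?_).subset fun v hv => ?_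
  · rwa [Ideal.zero_eq_bot, Ne, Ideal.span_singleton_eq_bot]
  · exact Ideal.dvd_span_singleton.mpr hv

/-! ### An auxiliary uniformizer; split primes of a quadratic extension -/

section Gamma

variable {E : Type*} [Field E] [NumberField E]

/-- **An integer which is a uniformizer at one place and a unit at finitely many others**
(Chinese remainder theorem in `𝓞 E`, Mathlib `IsDedekindDomain.exists_forall_sub_mem_ideal`):
for a finite place `u₀` and a finite set `T ∌ u₀` of finite places there is `γ ∈ 𝓞 E` with
`ord_{u₀}(γ) = 1` and `γ ∉ u` for all `u ∈ T`. [folklore] -/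
theorem exists_intValuation_eq_exp_neg_one_and_forall_not_mem (u₀ : HeightOneSpectrum (𝓞 E))
    (T : Finset (HeightOneSpectrum (𝓞 E))) (hT : u₀ ∉ T) :
    ∃ γ : 𝓞 E, u₀.intValuation γ = WithZero.exp (-1 : ℤ) ∧ ∀ u ∈ T, γ ∉ u.asIdeal := by
  classical
  obtain ⟨π, hπ⟩ := u₀.intValuation_exists_uniformizer
  obtain ⟨y, hy⟩ := IsDedekindDomain.exists_forall_sub_mem_ideal (s := insert u₀ T)
    (fun u : HeightOneSpectrum (𝓞 E) => u.asIdeal) (fun u => if u = u₀ then 2 else 1)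
    (fun u _ => u.prime) (fun u _ u' _ h => fun h' => h (HeightOneSpectrum.ext h'))
    (fun u => if (u : HeightOneSpectrum (𝓞 E)) = u₀ then π else 1)
  refine ⟨y, ?_, fun u hu hyu => ?_⟩
  · have h0 := hy u₀ (Finset.mem_insert_self u₀ T)
    simp only [if_true] at h0
    have hlt : u₀.intValuation (y - π) < u₀.intValuation π := by
      rw [hπ]
      refine lt_of_le_of_lt ((u₀.intValuation_le_pow_iff_mem (y - π) 2).mpr h0) ?_
      exact WithZero.exp_lt_exp.mpr (by norm_num)
    rw [← hπ, ← Valuation.map_add_eq_of_lt_left _ hlt, add_sub_cancel]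
  · have hne : u ≠ u₀ := fun h => hT (h ▸ hu)
    have h1 := hy u (Finset.mem_insert_of_mem hu)
    simp only [hne, if_false, pow_one] at h1
    have : (1 : 𝓞 E) ∈ u.asIdeal := by
      have := u.asIdeal.sub_mem hyu h1
      rwa [sub_sub_cancel] at this
    exact u.isPrime.ne_top ((Ideal.eq_top_iff_one _).mpr this)

end Gamma

section Split

variable (K : Type*) {E : Type*} [Field K] [NumberField K] [Field E] [NumberField E] [Algebra K E]

/-- **Above a prime of `K` that splits completely in the quadratic Galois extension `E`, the
non-trivial automorphism of `E/K` moves every prime**: the two primes above a split prime are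
permuted transitively by `Gal(E/K)` (Cassels–Fröhlich, Ch. VII Prop. 1.2 (ii)), and there are
`[E:K] = 2` of them. [folklore] -/
theorem smul_ne_self_of_mem_splitPrimes [IsGalois K E] (hd : Module.finrank K E = 2)
    {u : HeightOneSpectrum (𝓞 E)} (hu : u.under (𝓞 K) ∈ splitPrimes K E) {σ : E ≃ₐ[K] E}
    (hσ : σ ≠ 1) : σ • u ≠ u := by
  intro hσu
  have hcard : (((u.under (𝓞 K)).asIdeal).primesOver (𝓞 E)).ncard = 2 := by
    rw [ncard_primesOver_of_mem_splitPrimes hu, hd]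
  obtain ⟨Q', hQ', hne⟩ := Set.exists_ne_of_one_lt_ncard (by rw [hcard]; exact one_lt_two) u.asIdeal
  have hQ'bot : Q' ≠ ⊥ := Ideal.ne_bot_of_mem_primesOver (u.under (𝓞 K)).ne_bot hQ'
  set u' : HeightOneSpectrum (𝓞 E) := ⟨Q', hQ'.1, hQ'bot⟩ with hu'
  have hunder : u.under (𝓞 K) = u'.under (𝓞 K) := HeightOneSpectrum.ext hQ'.2.over
  obtain ⟨τ, hτ⟩ := Automorphic.HeightOneSpectrum.exists_algEquiv_smul_eq K hunder
  have hτ1 : τ ≠ 1 := by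
    rintro rfl
    rw [one_smul] at hτ
    exact hne (congrArg HeightOneSpectrum.asIdeal hτ).symm
  -- `Gal(E/K) = {1, τ}`, so `σ = τ`
  have hG : Nat.card (E ≃ₐ[K] E) = 2 := by rw [IsGalois.card_aut_eq_finrank, hd]
  obtain ⟨y, -, hy⟩ := (Nat.card_eq_two_iff' (1 : E ≃ₐ[K] E)).mp hG
  rw [show σ = τ by rw [hy σ hσ, hy τ hτ1], hτ] at hσu
  exact hne (congrArg HeightOneSpectrum.asIdeal hσu)

/-- **There are infinitely many primes of `E` above the completely split primes of `E/K`**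
(`E/K` Galois): the completely split primes of `K` have density `1/[E:K] > 0`
(`hasStrongDirichletDensity_splitPrimes`), hence are infinitely many, and each has a prime of `E`
above it. [folklore] -/
theorem infinite_setOf_under_mem_splitPrimes [IsGalois K E] :
    {u : HeightOneSpectrum (𝓞 E) | u.under (𝓞 K) ∈ splitPrimes K E}.Infinite := by
  have hdens := hasStrongDirichletDensity_splitPrimes K E
  have hpos : (0 : ℝ) < 1 / (Module.finrank K E : ℕ) := by
    have : (0 : ℝ) < (Module.finrank K E : ℕ) := by exact_mod_cast Module.finrank_pos
    positivity
  have hinf : (splitPrimes K E).Infinite := hdens.infinite hpos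
  intro hfin
  apply hinf
  refine (hfin.image fun u : HeightOneSpectrum (𝓞 E) => u.under (𝓞 K)).subset fun q hq => ?_
  haveI := q.isMaximal
  obtain ⟨Q, hQmax, hQover⟩ :=
    Ideal.exists_maximal_ideal_liesOver_of_isIntegral (S := 𝓞 E) q.asIdeal
  have hQbot : Q ≠ ⊥ := Ideal.ne_bot_of_liesOver_of_ne_bot q.ne_bot Q
  set u : HeightOneSpectrum (𝓞 E) := ⟨Q, hQmax.isPrime, hQbot⟩
  have hu : u.under (𝓞 K) = q := HeightOneSpectrum.ext hQover.over.symm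
  exact ⟨u, by rw [Set.mem_setOf_eq, hu]; exact hq, hu⟩

end Split

/-! ### The Kummer quadratic character and inertia -/

section Kummer

variable {E : Type*} [Field E] [NumberField E]

omit [NumberField E] in
/-- `(√γ)² = γ` in `Ē` for `γ ∈ 𝓞 E` (through `𝓞 E → E → Ē`). [folklore] -/
theorem geomSqrt_sq_eq_algebraMap_ringOfIntegers (γ : 𝓞 E) :
    geomSqrt (γ : E) ^ 2 = algebraMap (𝓞 E) (AlgebraicClosure E) γ := by
  rw [geomSqrt_sq, IsScalarTower.algebraMap_apply (𝓞 E) E (AlgebraicClosure E)]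

omit [NumberField E] in
/-- A finite place above an odd prime `p` does not contain `2`. [folklore] -/
theorem two_not_mem_of_natCast_prime_mem {p : ℕ} (hp : p.Prime) (hp2 : p ≠ 2)
    {u : HeightOneSpectrum (𝓞 E)} (hu : ((p : ℕ) : 𝓞 E) ∈ u.asIdeal) : (2 : 𝓞 E) ∉ u.asIdeal := by
  intro h2
  obtain ⟨k, hk⟩ := hp.odd_of_ne_two hp2
  have h1 : (1 : 𝓞 E) = (p : 𝓞 E) - 2 * k := by
    rw [hk]; push_cast; ring
  exact u.isPrime.ne_top ((Ideal.eq_top_iff_one _).mpr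
    (h1 ▸ u.asIdeal.sub_mem hu (u.asIdeal.mul_mem_right _ h2)))

/-- **The inertia groups above a place `u ∤ p` fix the `p`-th roots of unity**: `I_𝔔 ≤ Γ_{E(ζ_p)}`
for `𝔔 ∣ u` (`E(μ_p)/E` is unramified outside `p`: the roots of `X^p - 1` stay distinct modulo
`𝔔 ∌ p`; Lang, *Fundamentals of Diophantine Geometry*, Ch. 6 Prop. 1.3). [folklore] -/
theorem inertia_le_absGaloisGroupAdjoinRootsOfUnity {p : ℕ} {u : HeightOneSpectrum (𝓞 E)}
    (hpu : ((p : ℕ) : 𝓞 E) ∉ u.asIdeal) {𝔔 : Ideal (absIntegers (𝓞 E) E)} (h𝔔 : 𝔔 ∈ u.primesAbove) :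
    𝔔.inertia (absoluteGaloisGroup E) ≤ absGaloisGroupAdjoinRootsOfUnity E p := by
  intro σ hσ
  rw [mem_absGaloisGroupAdjoinRootsOfUnity_iff]
  intro x hx
  exact EllipticCurves.absoluteGaloisGroup_inertia_fixes_root_of_not_mem (d := p) (a := 1) u
    (fun h => u.isPrime.ne_top ((Ideal.eq_top_iff_one _).mpr h)) hpu
    (by rw [map_one]; exact hx) h𝔔 hσ

/-- **The local inertia group maps into a global one**: `res(I_{E_u}) ⊆ I_{𝔓₀}` for the prime
`𝔓₀ = adicCompletionPrime E u` above `u` cut out by the chosen `Ē → \bar E_u`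
(`inertia_adicCompletionPrime_eq_map_absInertia`). [folklore] -/
theorem absGaloisRestrict_mem_inertia_adicCompletionPrime (u : HeightOneSpectrum (𝓞 E))
    {σ : absoluteGaloisGroup (u.adicCompletion E)} (hσ : σ ∈ absInertia (u.adicCompletion E)) :
    absGaloisRestrict E (u.adicCompletion E) σ ∈
      (adicCompletionPrime E u).inertia (absoluteGaloisGroup E) := by
  rw [inertia_adicCompletionPrime_eq_map_absInertia]
  exact Subgroup.mem_map_of_mem _ hσ

/-- **The quadratic Kummer character `χ_γ` of `E(√γ)/E` for `γ ∈ 𝓞 E` a unit above `p`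
(`p` odd)**: a continuous character `q' : Γ_E → {±1} ⊆ Aˣ` with `q'(σ) = ±1` according as
`σ√γ = ±√γ`, trivial on every inertia group above every place `u ∣ p` — globally (`I_𝔔`,
`𝔔 ∣ u`) and locally (`I_{E_u}` through `res : Γ_{E_u} → Γ_E`) — because `γ` and `2` are
`u`-units (Lang, *FDG* Ch. 6 Prop. 1.3: `E(√γ)/E` is unramified at `u`). [folklore] -/
theorem exists_kummerQuadraticCharacter {p : ℕ} (hp : p.Prime) (hp2 : p ≠ 2) {γ : 𝓞 E}
    (hγ0 : γ ≠ 0)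
    (hγp : ∀ u : HeightOneSpectrum (𝓞 E), ((p : ℕ) : 𝓞 E) ∈ u.asIdeal → γ ∉ u.asIdeal)
    (A : Type*) [CommRing A] [TopologicalSpace A] :
    ∃ q' : absoluteGaloisGroup E →ₜ* Aˣ,
      (∀ σ, σ • geomSqrt (γ : E) = geomSqrt (γ : E) → q' σ = 1) ∧
      (∀ σ, σ • geomSqrt (γ : E) = -geomSqrt (γ : E) → q' σ = -1) ∧
      (∀ σ, q' σ = 1 ∨ q' σ = -1) ∧
      (∀ u : HeightOneSpectrum (𝓞 E), ((p : ℕ) : 𝓞 E) ∈ u.asIdeal →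
        ∀ 𝔔 ∈ u.primesAbove, ∀ σ ∈ 𝔔.inertia (absoluteGaloisGroup E), q' σ = 1) ∧
      (∀ u : HeightOneSpectrum (𝓞 E), ((p : ℕ) : 𝓞 E) ∈ u.asIdeal →
        ∀ σ ∈ absInertia (u.adicCompletion E),
          q' (absGaloisRestrict E (u.adicCompletion E) σ) = 1) := by
  have hγ0' : (γ : E) ≠ 0 := fun h => hγ0 (RingOfIntegers.coe_eq_zero_iff.mp h)
  obtain ⟨q', h1, h2, h3⟩ := EllipticCurves.exists_continuousQuadraticCharacter hγ0' A
  have hglob : ∀ u : HeightOneSpectrum (𝓞 E), ((p : ℕ) : 𝓞 E) ∈ u.asIdeal →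
      ∀ 𝔔 ∈ u.primesAbove, ∀ σ ∈ 𝔔.inertia (absoluteGaloisGroup E), q' σ = 1 := by
    intro u hu 𝔔 h𝔔 σ hσ
    refine h1 σ (EllipticCurves.absoluteGaloisGroup_inertia_fixes_root_of_not_mem (d := 2) u
      (hγp u hu) ?_ (geomSqrt_sq_eq_algebraMap_ringOfIntegers γ) h𝔔 hσ)
    exact_mod_cast two_not_mem_of_natCast_prime_mem hp hp2 hu
  exact ⟨q', h1, h2, h3, hglob, fun u hu σ hσ => hglob u hu _ (adicCompletionPrime_mem_primesAbove E u)
    _ (absGaloisRestrict_mem_inertia_adicCompletionPrime u hσ)⟩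

/-- **An inertia element at `u₀` acting by `-1` on `√γ`** when `ord_{u₀}(γ) = 1` and `u₀ ∤ 2`:
the Kummer character of a uniformizer is onto `μ₂` on the inertia group
(`exists_mem_absoluteGaloisGroup_inertia_smul_eq_pow_mul`, `ζ = -1`). [folklore] -/
theorem exists_mem_inertia_smul_geomSqrt_eq_neg {u₀ : HeightOneSpectrum (𝓞 E)} {γ : 𝓞 E}
    (hγ : u₀.intValuation γ = WithZero.exp (-1 : ℤ)) (h2 : (2 : 𝓞 E) ∉ u₀.asIdeal)
    {𝔔 : Ideal (absIntegers (𝓞 E) E)} (h𝔔 : 𝔔 ∈ u₀.primesAbove) :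
    ∃ σ : absoluteGaloisGroup E, σ ∈ 𝔔.inertia (absoluteGaloisGroup E) ∧
      σ • geomSqrt (γ : E) = -geomSqrt (γ : E) := by
  have hζ : IsPrimitiveRoot (-1 : AlgebraicClosure E) 2 := IsPrimitiveRoot.neg_one 0 (by decide)
  have hval : u₀.valuation E (γ : E) = WithZero.exp (-1 : ℤ) := by
    rw [show ((γ : E)) = algebraMap (𝓞 E) E γ from rfl, HeightOneSpectrum.valuation_of_algebraMap, hγ]
  obtain ⟨σ, hσ, hσγ⟩ := EllipticCurves.exists_mem_absoluteGaloisGroup_inertia_smul_eq_pow_mul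
    two_pos hζ u₀ (by exact_mod_cast h2) hval (geomSqrt_sq (γ : E)) h𝔔 1
  exact ⟨σ, hσ, by rw [hσγ, pow_one, neg_one_mul]⟩

end Kummer

end Literature.NumberTheory.GaloisRepresentations

end
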